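/- Fleet lead `ym-wcr-19456-p1`, route `WeakCouplingRates`, crux `ColdBoxTwoPointFloorW` (stmt-QuantumFields-19608). -/
import Literature.MathematicalPhysics.QuantumLattice.SU2HaarChart
import Literature.MathematicalPhysics.QuantumLattice.SU2HaarSmallBall
import Literature.MathematicalPhysics.QuantumFieldTheory.Balaban1983to89.T4HaarSU2Translate
import HarnessLib

/-!
# Crux `ColdBoxTwoPointFloor(W)`, piece S3c-ii step 4 (chart): multiplicativity of the quaternion model of `SU(2)` and the
# Taylor-ready cost formula `2 − Re tr P(x) = 2|im x|²/(‖x‖(‖x‖ + re x))`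

For the radial projection `P = quatToSU2 : ℍ ∖ {0} → SU(2)` of the tree (`SU2Haar.lean`; `su2Quat (P x) = x/‖x‖` is the tree's `T4HaarSU2Translate.su2Quat_quatToSU2`):
**`quatToSU2_mul_quatToSU2`** (`P(x)P(y) = P(xy)` — so a plaquette variable of links in the gnomonic chart is `P` of the quaternion PRODUCT
`(1,v₁)(1,v₂)(1,−v₃)(1,−v₄)`), `quatToSU2_one`, **`quatToSU2_gnomonicQuat_inv`** (`P(1,v)⁻¹ = P(1,−v)`: reversed links are the chart
points `−v`), and the cost identities `two_sub_trace_re_quatToSU2_eq` (`2 − Re tr P(x) = 2(‖x‖ − re x)/‖x‖`) and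
**`two_sub_trace_re_quatToSU2_eq_imSq`** (`= 2|im x|²/(‖x‖(‖x‖ + re x))`): the Wilson cost of a plaquette is QUADRATIC in the
imaginary part of the product quaternion with a denominator `→ 2` at the identity — the form in which the cubic remainder
`|cost(U_p) − |v₁+v₂−v₃−v₄|²| ≤ C·max|vᵢ|³` of the one-scale expansion (stub `stub_boxDirichletDomination`/`stub_boxGaussianDomination`)
is read off.  Companion of `…ColdBoxGnomonic` (single-link cost).  Everything proved; no definition; standard axioms.
-/

set_option autoImplicit false

noncomputable section

open Quaternion
open Literature.MathematicalPhysics.QuantumLattice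
open Literature.MathematicalPhysics.QuantumFieldTheory

namespace Summit.QuantumFields.YangMills.Theorems.WeakCouplingRates

/-- **The projection `ℍ ∖ {0} → SU(2)` is multiplicative**: `P(x) P(y) = P(xy)`. -/
theorem quatToSU2_mul_quatToSU2 {x y : ℍ} (hx : x ≠ 0) (hy : y ≠ 0) :
    quatToSU2 x * quatToSU2 y = quatToSU2 (x * y) := by
  rw [mul_quatToSU2 _ hy, Balaban1983to89.T4HaarSU2Translate.su2Quat_quatToSU2 hx, smul_mul_assoc,
    quatToSU2_smul (inv_pos.2 (norm_pos_iff.2 hx))]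

/-- `P(1) = 1`. -/
theorem quatToSU2_one : quatToSU2 (1 : ℍ) = 1 := by
  apply Subtype.ext
  rw [coe_quatToSU2_of_norm_eq_one norm_one, quatMatrix_one]
  rfl

/-- **The `SU(2)` inverse in the gnomonic chart is `v ↦ −v`**: `P(1, v)⁻¹ = P(1, −v)`. -/
theorem quatToSU2_gnomonicQuat_inv (v : Fin 3 → ℝ) :
    (quatToSU2 (gnomonicQuat v))⁻¹ = quatToSU2 (gnomonicQuat (-v)) := by
  rw [inv_eq_iff_mul_eq_one, quatToSU2_mul_quatToSU2 (gnomonicQuat_ne_zero v) (gnomonicQuat_ne_zero (-v))]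
  have hprod : gnomonicQuat v * gnomonicQuat (-v) = (1 + ∑ i, v i ^ 2) • (1 : ℍ) := by
    ext <;> simp [gnomonicQuat, Fin.sum_univ_three] <;> ring
  rw [hprod, quatToSU2_smul (by positivity), quatToSU2_one]

/-- `‖x‖² − (re x)² = |im x|²`. -/
theorem sq_norm_sub_sq_re (x : ℍ) : ‖x‖ ^ 2 - x.re ^ 2 = x.imI ^ 2 + x.imJ ^ 2 + x.imK ^ 2 := by
  rw [sq_norm_eq_sum_sq]; ring

/-- **The Wilson cost of a projected quaternion**: `2 − Re tr P(x) = 2(‖x‖ − re x)/‖x‖` (`x ≠ 0`). -/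
theorem two_sub_trace_re_quatToSU2_eq {x : ℍ} (hx : x ≠ 0) :
    2 - (((quatToSU2 x : Matrix.specialUnitaryGroup (Fin 2) ℂ) : Matrix (Fin 2) (Fin 2) ℂ).trace).re =
      2 * (‖x‖ - x.re) / ‖x‖ := by
  rw [trace_quatToSU2_re hx]
  have hn : ‖x‖ ≠ 0 := norm_ne_zero_iff.2 hx
  field_simp

/-- **… and in the Taylor-ready form** `2 − Re tr P(x) = 2 |im x|² / (‖x‖ (‖x‖ + re x))` whenever `‖x‖ + re x ≠ 0` (i.e. `x` is
not a negative real): the cost is quadratic in the imaginary part, with a denominator `→ 2` as `x → 1`. -/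
theorem two_sub_trace_re_quatToSU2_eq_imSq {x : ℍ} (hx : x ≠ 0) (hre : ‖x‖ + x.re ≠ 0) :
    2 - (((quatToSU2 x : Matrix.specialUnitaryGroup (Fin 2) ℂ) : Matrix (Fin 2) (Fin 2) ℂ).trace).re =
      2 * (x.imI ^ 2 + x.imJ ^ 2 + x.imK ^ 2) / (‖x‖ * (‖x‖ + x.re)) := by
  rw [two_sub_trace_re_quatToSU2_eq hx, ← sq_norm_sub_sq_re]
  have hn : ‖x‖ ≠ 0 := norm_ne_zero_iff.2 hx
  field_simp
  ring

end Summit.QuantumFields.YangMills.Theorems.WeakCouplingRates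

end
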